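import Mathlib
import HarnessLib
import Summits.HubbardSuperconductivity.HubbardSuperconductivity.Theorems.KLProgrammeKLRegimeEngineTowerDoorToKitPrescribed
import Summits.HubbardSuperconductivity.HubbardSuperconductivity.Theorems.KLProgrammeKLRegimeEngineTowerBlockIncrLevKit
import Summits.HubbardSuperconductivity.HubbardSuperconductivity.Theorems.KLProgrammeKLRegimeEngineTowerLandingCore

/-!
# Route `KLProgramme` — crux K3 ENGINE (stmt-HubbardSuperconductivity-20437 `KLRegimeEngineV17F2`), stub (b) v2, THE LEVELS PACKAGE (ℓ):
# instantiation (I1), «(I1)-LEV-GRADED-UNITS», kit side — the prescribed doors' brackets under a LEVEL-GRADED input majorant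
# (UNITS-MAP (p4 g17) §(6); cell gate-hubbard-kl, seat hubbard-kl-k3c2-p3 g12 as SUBSTITUTE typer while the E1 lineage is unseated — E1 may rename or supersede)

The dictionary `doorGradedPrescribed_le_kitStep` (…TowerDoorToKitPrescribed, p641981) reads every input vertex through ONE track-blind majorant
`ρc^c·ε·B m c ≤ N m`, so the kit step it feeds returns every output track in the same units.  The level gain at birth is profile-wise: in the graded
bracket vertex `a` carries `ρc^{c_a}·ε·B(δ_a, c_a)` with `c_a = |pf⁻¹ a|` known legs besides its pin and `Σ_a c_a = |Jt|` (the output's known legs besides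
the pinned one).  With a GRADED majorant `ρc^c·ε·B m c ≤ ω c·N m` whose weights are supermultiplicative, `ω a·ω b ≤ ω (a+b)` (for the e*-units
`ω c = 2^{−e*(c+1)J}` this is the consistency `e*(a+1)+e*(b+1) ≥ e*(a+b+1)` of LEV-UNITS-NOTE §1), every profile's product is `≤ ω(|Jt|)·Π_a τ^{δ_a} N(δ_a)`:

* §1 elementary rows: `prod_weight_le_weight_sum` (`Π_a ω(c a) ≤ ω(Σ_a c a)`), `towerS_le_towerV_pow` (`towerS ≤ towerV^n`) (+ E1's `sum_card_fiber_eq_card`),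
  `towerFO_mul_left`;
* §2 **`doorGradedPart_le_weight_mul`** — the graded part of the bracket at truncation `N₀` is `≤ ω(|Jt|)·Σ_{n ∈ [2, N₀−1]} e·Φ^{n−1}·ψ^p·towerS D τ N n p`;
  **`doorTailPart_le_kitTail`** — the tail (inputs read at `c = 0`, no gain) is `≤ ψ^p·e·V·(ΦV)^{N₀−1}/(1 − ΦV)`, `V = towerV D τ N`, `Φ = eα/κ²`;
* §3 **`doorGradedPrescribed_le_kitStep_graded`** — RE-TRUNCATION: for the kit's `N ≥ 1` and any `K` with `(1/2)^K ≤ ω(|Jt|)`, calling the door at `N₀ := N + K + 1`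
  and bounding the extra graded orders by tail terms (`towerS ≤ towerV^n`, geometric partial sums) gives, under the quantitative guard `2Φ·V < 1`, the bracket
  `≤ ω(|Jt|)·(Σ_{n ∈ [2, N]} e·(2Φ)^{n−1}·ψ^p·towerS D τ N n p + ψ^p·e·V·(2Φ·V)^N/(1 − 2Φ·V))` — the LITERAL kit shape with `Φ ↦ 2Φ`, in the output track's units;
* §4 **`doorBinomialPrescribedJ_le_towerFO_graded`** — the first-order term reads its one vertex at `c = |J|`: factor `ω(|J|)` directly.
Pure real algebra over the landed dictionary; no model objects.  Nothing asserts (ℓ), any stub, K3 or superconductivity.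
References: BGM 2006 §3 (3.2)–(3.8) (sector counting per vertex, level by level) [cite: BenfattoGiulianiMastropietro2006].
-/

noncomputable section

namespace Summit.HubbardSuperconductivity.HubbardSuperconductivity.Theorems.EngineV8

set_option linter.dupNamespace false -- summit = problem name (single-conjunct summit), D-0017

open Real Finset Literature.MathematicalPhysics.QuantumLattice
open scoped Nat

/-! ## §1 Elementary rows -/

/-- **Supermultiplicative weights multiply below the weight of the total**: `Π_{a : Fin (n+1)} ω(c a) ≤ ω(Σ_a c a)` for `ω ≥ 0` with `ω a·ω b ≤ ω (a+b)`. -/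
theorem prod_weight_le_weight_sum {ω : ℕ → ℝ} (hω0 : ∀ c, 0 ≤ ω c) (hωmul : ∀ a b, ω a * ω b ≤ ω (a + b)) :
    ∀ (n : ℕ) (c : Fin (n + 1) → ℕ), ∏ a, ω (c a) ≤ ω (∑ a, c a) := by
  intro n
  induction n with
  | zero => intro c; simp
  | succ n ih =>
    intro c
    rw [Fin.prod_univ_succ, Fin.sum_univ_succ]
    exact (mul_le_mul_of_nonneg_left (ih fun a => c a.succ) (hω0 _)).trans (hωmul _ _)

/-- The same on `Fin n` with `1 ≤ n`. -/
theorem prod_weight_le_weight_sum' {ω : ℕ → ℝ} (hω0 : ∀ c, 0 ≤ ω c) (hωmul : ∀ a b, ω a * ω b ≤ ω (a + b)) {n : ℕ} (hn : 1 ≤ n)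
    (c : Fin n → ℕ) : ∏ a, ω (c a) ≤ ω (∑ a, c a) := by
  obtain ⟨k, rfl⟩ := Nat.exists_eq_add_of_le' hn
  exact prod_weight_le_weight_sum hω0 hωmul k c

/-- **`towerS ≤ towerV^n`**: dropping the degree constraint and `τ^m ≤ (eτ)^m`. -/
theorem towerS_le_towerV_pow {D n p : ℕ} {τ : ℝ} {μ : ℕ → ℝ} (hτ : 0 ≤ τ) (hμ : ∀ m, 0 ≤ μ m) :
    towerS D τ μ n p ≤ towerV D τ μ ^ n := by
  unfold towerS towerV
  have hτe : τ ≤ exp 1 * τ := le_mul_of_one_le_left hτ (one_le_exp zero_le_one)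
  calc ∑ δ ∈ (Fintype.piFinset fun _ : Fin n => Icc 1 D) with p + n - 1 ≤ ∑ a, δ a, ∏ a, τ ^ (δ a) * μ (δ a)
      ≤ ∑ δ ∈ Fintype.piFinset fun _ : Fin n => Icc 1 D, ∏ a, τ ^ (δ a) * μ (δ a) :=
        sum_le_sum_of_subset_of_nonneg (filter_subset _ _) fun δ _ _ => prod_nonneg fun a _ => mul_nonneg (pow_nonneg hτ _) (hμ _)
    _ = ∏ _a : Fin n, ∑ m ∈ Icc 1 D, τ ^ m * μ m := (Finset.prod_univ_sum (fun _ : Fin n => Icc 1 D) fun _ m => τ ^ m * μ m).symm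
    _ = (∑ m ∈ Icc 1 D, τ ^ m * μ m) ^ n := by rw [prod_const, card_univ, Fintype.card_fin]
    _ ≤ (∑ m ∈ Icc 1 D, (exp 1 * τ) ^ m * μ m) ^ n :=
        pow_le_pow_left₀ (sum_nonneg fun m _ => mul_nonneg (pow_nonneg hτ _) (hμ _))
          (sum_le_sum fun m _ => mul_le_mul_of_nonneg_right (pow_le_pow_left₀ hτ hτe _) (hμ _)) _

/-- `towerFO` is linear in the sizes: a constant weight comes out. -/
theorem towerFO_mul_left {D : ℕ} (σ w : ℝ) (μ : ℕ → ℝ) (p : ℕ) : towerFO D σ (fun m => w * μ m) p = w * towerFO D σ μ p := by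
  unfold towerFO
  rw [mul_sum]
  exact sum_congr rfl fun m _ => by ring

/-! ## §2 The graded part gains `ω(|Jt|)`; the tail gains nothing -/

/-- **THE GRADED PART OF THE PRESCRIBED BRACKET UNDER A GRADED MAJORANT** (orders `2 ≤ n < N₀`): with `ρc^c·ε·B m c ≤ ω c·N m`, `ω ≥ 0` supermultiplicative,
`N ≥ 0`, `N 0 = 0`, `D ≥ |Γ|/2`, `m + 1 = 2p`, `τ ≥ (e³κ)²`, `ψ ≥ κ⁻²`:
`Σ_{n} (κ^{−(m+1)}κ^{−2(n−1)}α^{n−1}eⁿ)·Σ_δ Σ_pf w_pf·Π_a (e³κ)^{2δ_a}·ρc^{c_a}·ε·B(δ_a, c_a) ≤ ω(|Jt|)·Σ_{n ∈ [2, N₀−1]} e·Φ^{n−1}·ψ^p·towerS D τ N n p`. -/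
theorem doorGradedPart_le_weight_mul {Γ : Type*} [Fintype Γ] {Jt : Type*} [Fintype Jt] [DecidableEq Jt]
    {κ α ρc ε : ℝ} (hκ : 0 < κ) (hα : 0 ≤ α) (hρc : 0 ≤ ρc) (hε : 0 ≤ ε)
    {B : ℕ → ℕ → ℝ} (hB0 : ∀ m c, 0 ≤ B m c) {N : ℕ → ℝ} (hN0 : ∀ m, 0 ≤ N m) (hN00 : N 0 = 0)
    {ω : ℕ → ℝ} (hω0 : ∀ c, 0 ≤ ω c) (hωmul : ∀ a b, ω a * ω b ≤ ω (a + b))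
    (hNB : ∀ m c, ρc ^ c * (ε * B m c) ≤ ω c * N m)
    {D : ℕ} (hD : Fintype.card Γ / 2 ≤ D) (N₀ : ℕ) {m p : ℕ} (hmp : m + 1 = 2 * p)
    {τ ψ : ℝ} (hτ1 : (exp 3 * κ) ^ 2 ≤ τ) (hψ1 : κ⁻¹ ^ 2 ≤ ψ) :
    ∑ n ∈ Ico 2 N₀, (κ⁻¹ ^ (m + 1) * κ⁻¹ ^ (2 * (n - 1)) * (α ^ (n - 1) * exp n)) *
        ∑ δ ∈ (Fintype.piFinset fun _ : Fin n => range (Fintype.card Γ / 2 + 1)) with m + 1 + 2 * (n - 1) ≤ ∑ a, 2 * δ a,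
          ∑ pf : Jt → Fin n, ((∏ j, ((2 * δ (pf j) : ℕ) : ℝ)) / ((∑ a, 2 * δ a : ℕ) : ℝ) ^ Fintype.card Jt) *
            ∏ a, (exp 3 * κ) ^ (2 * δ a) *
              (ρc ^ (univ.filter fun j : Jt => pf j = a).card * (ε * B (δ a) (univ.filter fun j : Jt => pf j = a).card)) ≤
      ω (Fintype.card Jt) * ∑ n ∈ Icc 2 (N₀ - 1), exp 1 * (exp 1 * α / κ ^ 2) ^ (n - 1) * ψ ^ p * towerS D τ N n p := by
  set Φ := exp 1 * α / κ ^ 2 with hΦ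
  have hΦ0 : 0 ≤ Φ := by rw [hΦ]; positivity
  have he3 : 0 ≤ exp 3 * κ := by positivity
  have hτ0 : 0 ≤ (exp 3 * κ) ^ 2 := by positivity
  have hτ0' : 0 ≤ τ := hτ0.trans hτ1
  have hψ0 : 0 ≤ ψ := le_trans (by positivity) hψ1
  have hωJ : 0 ≤ ω (Fintype.card Jt) := hω0 _
  have hIco : Ico 2 N₀ = Icc 2 (N₀ - 1) := by
    ext n; simp only [mem_Ico, mem_Icc]; omega
  rw [hIco, mul_sum]
  refine sum_le_sum fun n hn => ?_
  have hn1 : 1 ≤ n := by have := (mem_Icc.1 hn).1; omega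
  have hcoef : κ⁻¹ ^ (m + 1) * κ⁻¹ ^ (2 * (n - 1)) * (α ^ (n - 1) * exp n) = exp 1 * Φ ^ (n - 1) * (κ⁻¹ ^ 2) ^ p := by
    have h := door_coef_eq hκ.ne' (ρ := κ) α p (n - 1)
    rw [show n - 1 + 1 = n by omega] at h
    rw [hmp, hΦ]
    exact h
  rw [hcoef]
  have hc0 : 0 ≤ exp 1 * Φ ^ (n - 1) * (κ⁻¹ ^ 2) ^ p := by positivity
  have hcψ : exp 1 * Φ ^ (n - 1) * (κ⁻¹ ^ 2) ^ p ≤ exp 1 * Φ ^ (n - 1) * ψ ^ p :=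
    mul_le_mul_of_nonneg_left (pow_le_pow_left₀ (by positivity) hψ1 p) (by positivity)
  -- inner sum: profile-wise `Π_a ω(c_a) ≤ ω(|Jt|)`, average the profiles away, enlarge to `τ` and the range, then it IS `towerS`
  have hinner : ∑ δ ∈ (Fintype.piFinset fun _ : Fin n => range (Fintype.card Γ / 2 + 1)) with m + 1 + 2 * (n - 1) ≤ ∑ a, 2 * δ a,
        ∑ pf : Jt → Fin n, ((∏ j, ((2 * δ (pf j) : ℕ) : ℝ)) / ((∑ a, 2 * δ a : ℕ) : ℝ) ^ Fintype.card Jt) *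
          ∏ a, (exp 3 * κ) ^ (2 * δ a) *
            (ρc ^ (univ.filter fun j : Jt => pf j = a).card * (ε * B (δ a) (univ.filter fun j : Jt => pf j = a).card)) ≤
      ω (Fintype.card Jt) * towerS D τ N n p := by
    have hsub : ((Fintype.piFinset fun _ : Fin n => range (Fintype.card Γ / 2 + 1)).filter
          fun δ : Fin n → ℕ => m + 1 + 2 * (n - 1) ≤ ∑ a, 2 * δ a) ⊆
        ((Fintype.piFinset fun _ : Fin n => range (D + 1)).filter fun δ : Fin n → ℕ => 2 * p + 2 * (n - 1) ≤ ∑ a, 2 * δ a) := by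
      intro δ hδ
      rw [mem_filter, Fintype.mem_piFinset] at hδ ⊢
      exact ⟨fun a => mem_range.2 (lt_of_lt_of_le (mem_range.1 (hδ.1 a)) (by omega)), hmp ▸ hδ.2⟩
    have hδ : ∀ δ : Fin n → ℕ,
        ∑ pf : Jt → Fin n, ((∏ j, ((2 * δ (pf j) : ℕ) : ℝ)) / ((∑ a, 2 * δ a : ℕ) : ℝ) ^ Fintype.card Jt) *
            ∏ a, (exp 3 * κ) ^ (2 * δ a) *
              (ρc ^ (univ.filter fun j : Jt => pf j = a).card * (ε * B (δ a) (univ.filter fun j : Jt => pf j = a).card)) ≤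
          ω (Fintype.card Jt) * ∏ a, τ ^ (δ a) * N (δ a) := by
      intro δ
      have hY0 : 0 ≤ ∏ a, τ ^ (δ a) * N (δ a) := prod_nonneg fun a _ => mul_nonneg (pow_nonneg hτ0' _) (hN0 _)
      have hterm : ∀ pf : Jt → Fin n,
          ((∏ j, ((2 * δ (pf j) : ℕ) : ℝ)) / ((∑ a, 2 * δ a : ℕ) : ℝ) ^ Fintype.card Jt) *
              ∏ a, (exp 3 * κ) ^ (2 * δ a) *
                (ρc ^ (univ.filter fun j : Jt => pf j = a).card * (ε * B (δ a) (univ.filter fun j : Jt => pf j = a).card)) ≤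
            ((∏ j, ((2 * δ (pf j) : ℕ) : ℝ)) / ((∑ a, 2 * δ a : ℕ) : ℝ) ^ Fintype.card Jt) *
              (ω (Fintype.card Jt) * ∏ a, τ ^ (δ a) * N (δ a)) := by
        intro pf
        refine mul_le_mul_of_nonneg_left ?_ (by positivity)
        -- vertex by vertex: `(e³κ)^{2δ}·ρc^{c}·ε·B(δ, c) ≤ ω(c)·(τ^δ·N δ)`
        have hv : ∏ a, (exp 3 * κ) ^ (2 * δ a) *
              (ρc ^ (univ.filter fun j : Jt => pf j = a).card * (ε * B (δ a) (univ.filter fun j : Jt => pf j = a).card)) ≤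
            ∏ a, ω (univ.filter fun j : Jt => pf j = a).card * (τ ^ (δ a) * N (δ a)) := by
          refine prod_le_prod (fun a _ => ?_) fun a _ => ?_
          · exact mul_nonneg (pow_nonneg he3 _) (mul_nonneg (pow_nonneg hρc _) (mul_nonneg hε (hB0 _ _)))
          · rw [pow_mul]
            calc ((exp 3 * κ) ^ 2) ^ δ a *
                  (ρc ^ (univ.filter fun j : Jt => pf j = a).card * (ε * B (δ a) (univ.filter fun j : Jt => pf j = a).card))
                ≤ τ ^ δ a * (ω (univ.filter fun j : Jt => pf j = a).card * N (δ a)) :=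
                  mul_le_mul (pow_le_pow_left₀ hτ0 hτ1 _) (hNB _ _)
                    (mul_nonneg (pow_nonneg hρc _) (mul_nonneg hε (hB0 _ _))) (pow_nonneg hτ0' _)
              _ = _ := by ring
        refine hv.trans ?_
        rw [prod_mul_distrib]
        refine mul_le_mul_of_nonneg_right ?_ hY0
        -- `Π_a ω(c_a) ≤ ω(Σ_a c_a) = ω(|Jt|)`
        have h := prod_weight_le_weight_sum' hω0 hωmul hn1 fun a => (univ.filter fun j : Jt => pf j = a).card
        rwa [sum_card_fiber_eq_card pf] at h
      calc _ ≤ ∑ pf : Jt → Fin n, ((∏ j, ((2 * δ (pf j) : ℕ) : ℝ)) / ((∑ a, 2 * δ a : ℕ) : ℝ) ^ Fintype.card Jt) *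
            (ω (Fintype.card Jt) * ∏ a, τ ^ (δ a) * N (δ a)) := sum_le_sum fun pf _ => hterm pf
        _ = (∑ pf : Jt → Fin n, (∏ j, ((2 * δ (pf j) : ℕ) : ℝ)) / ((∑ a, 2 * δ a : ℕ) : ℝ) ^ Fintype.card Jt) *
            (ω (Fintype.card Jt) * ∏ a, τ ^ (δ a) * N (δ a)) := by rw [sum_mul]
        _ ≤ 1 * (ω (Fintype.card Jt) * ∏ a, τ ^ (δ a) * N (δ a)) :=
            mul_le_mul_of_nonneg_right (sum_landingWeights_cast_le_one δ) (mul_nonneg hωJ hY0)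
        _ = _ := one_mul _
    calc _ ≤ ∑ δ ∈ (Fintype.piFinset fun _ : Fin n => range (Fintype.card Γ / 2 + 1)) with m + 1 + 2 * (n - 1) ≤ ∑ a, 2 * δ a,
          ω (Fintype.card Jt) * ∏ a, τ ^ (δ a) * N (δ a) := sum_le_sum fun δ _ => hδ δ
      _ ≤ ∑ δ ∈ (Fintype.piFinset fun _ : Fin n => range (D + 1)) with 2 * p + 2 * (n - 1) ≤ ∑ a, 2 * δ a,
          ω (Fintype.card Jt) * ∏ a, τ ^ (δ a) * N (δ a) :=
          sum_le_sum_of_subset_of_nonneg hsub fun δ _ _ => mul_nonneg hωJ (prod_nonneg fun a _ => mul_nonneg (pow_nonneg hτ0' _) (hN0 _))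
      _ = ω (Fintype.card Jt) * towerS D τ N n p := by rw [← mul_sum, sum_range_filter_prod_eq_towerS hn1 hN00 p]
  have hS0 : 0 ≤ towerS D τ N n p := towerS_nonneg hτ0' hN0 n p
  calc _ ≤ exp 1 * Φ ^ (n - 1) * (κ⁻¹ ^ 2) ^ p * (ω (Fintype.card Jt) * towerS D τ N n p) := mul_le_mul_of_nonneg_left hinner hc0
    _ ≤ exp 1 * Φ ^ (n - 1) * ψ ^ p * (ω (Fintype.card Jt) * towerS D τ N n p) := mul_le_mul_of_nonneg_right hcψ (mul_nonneg hωJ hS0)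
    _ = _ := by ring

/-- **THE TAIL OF THE PRESCRIBED BRACKET GAINS NOTHING** (orders `≥ N₀` read their inputs at `c = 0`): with `ρc⁰·ε·B m 0 ≤ N m`, `N ≥ 0`, `N 0 = 0`, `D ≥ |Γ|/2`,
`m + 1 = 2p`, `τ ≥ (e²(κ+ρ))²`, `ψ ≥ ρ⁻²` and the guard `Φ·towerV D τ N < 1`:
`ρ^{−(m+1)}·e·normV·(eα·normV/κ²)^{N₀−1}/(1 − eα·normV/κ²) ≤ ψ^p·(e·V·(Φ·V)^{N₀−1}/(1 − Φ·V))`, `V = towerV D τ N`. -/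
theorem doorTailPart_le_kitTail {Γ : Type*} [Fintype Γ] {κ ρ α ρc ε : ℝ} (hκ : 0 < κ) (hρ : 0 < ρ) (hα : 0 ≤ α) (hρc : 0 ≤ ρc) (hε : 0 ≤ ε)
    {B : ℕ → ℕ → ℝ} (hB0 : ∀ m c, 0 ≤ B m c) {N : ℕ → ℝ} (hN0 : ∀ m, 0 ≤ N m) (hN00 : N 0 = 0)
    (hNB0 : ∀ m, ρc ^ 0 * (ε * B m 0) ≤ N m)
    {D : ℕ} (hD : Fintype.card Γ / 2 ≤ D) (N₀ : ℕ) {m p : ℕ} (hmp : m + 1 = 2 * p)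
    {τ ψ : ℝ} (hτ2 : (exp 2 * (κ + ρ)) ^ 2 ≤ τ) (hψ2 : ρ⁻¹ ^ 2 ≤ ψ)
    (hguard : exp 1 * α / κ ^ 2 * towerV D τ N < 1) :
    ρ⁻¹ ^ (m + 1) * (exp 1 * normV Γ κ ρ (fun m' => ρc ^ 0 * (ε * B m' 0))) *
        (exp 1 * α * normV Γ κ ρ (fun m' => ρc ^ 0 * (ε * B m' 0)) / κ ^ 2) ^ (N₀ - 1) /
        (1 - exp 1 * α * normV Γ κ ρ (fun m' => ρc ^ 0 * (ε * B m' 0)) / κ ^ 2) ≤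
      ψ ^ p * (exp 1 * towerV D τ N * (exp 1 * α / κ ^ 2 * towerV D τ N) ^ (N₀ - 1) / (1 - exp 1 * α / κ ^ 2 * towerV D τ N)) := by
  set Φ := exp 1 * α / κ ^ 2 with hΦ
  have hΦ0 : 0 ≤ Φ := by rw [hΦ]; positivity
  have hψ0 : 0 ≤ ψ := le_trans (by positivity) hψ2
  have hN'0 : ∀ m', 0 ≤ ρc ^ 0 * (ε * B m' 0) := fun m' => mul_nonneg (pow_nonneg hρc _) (mul_nonneg hε (hB0 _ _))
  have hV1 : normV Γ κ ρ (fun m' => ρc ^ 0 * (ε * B m' 0)) ≤ normV Γ κ ρ N := normV_mono hκ.le hρ.le hNB0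
  have hV2 : normV Γ κ ρ N ≤ towerV D ((exp 2 * (κ + ρ)) ^ 2) N := normV_le_towerV hκ.le hρ.le hN0 hN00 hD
  have hV3 : towerV D ((exp 2 * (κ + ρ)) ^ 2) N ≤ towerV D τ N := towerV_mono (by positivity) hτ2 hN0 fun _ => le_rfl
  have hV := hV1.trans (hV2.trans hV3)
  have hV0 : 0 ≤ normV Γ κ ρ (fun m' => ρc ^ 0 * (ε * B m' 0)) := normV_nonneg hκ.le hρ.le hN'0
  have htail := geomTail_mono hΦ0 hV0 hV hguard (N₀ - 1)
  have hψp : ρ⁻¹ ^ (m + 1) ≤ ψ ^ p := by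
    rw [hmp, pow_mul]; exact pow_le_pow_left₀ (by positivity) hψ2 p
  have hlhs : ρ⁻¹ ^ (m + 1) * (exp 1 * normV Γ κ ρ (fun m' => ρc ^ 0 * (ε * B m' 0))) *
        (exp 1 * α * normV Γ κ ρ (fun m' => ρc ^ 0 * (ε * B m' 0)) / κ ^ 2) ^ (N₀ - 1) /
        (1 - exp 1 * α * normV Γ κ ρ (fun m' => ρc ^ 0 * (ε * B m' 0)) / κ ^ 2) =
      ρ⁻¹ ^ (m + 1) * (exp 1 * normV Γ κ ρ (fun m' => ρc ^ 0 * (ε * B m' 0)) *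
        (Φ * normV Γ κ ρ (fun m' => ρc ^ 0 * (ε * B m' 0))) ^ (N₀ - 1) / (1 - Φ * normV Γ κ ρ (fun m' => ρc ^ 0 * (ε * B m' 0)))) := by
    rw [hΦ]
    have : exp 1 * α * normV Γ κ ρ (fun m' => ρc ^ 0 * (ε * B m' 0)) / κ ^ 2 =
        exp 1 * α / κ ^ 2 * normV Γ κ ρ (fun m' => ρc ^ 0 * (ε * B m' 0)) := by ring
    rw [this]; ring
  rw [hlhs]
  have hTd0 : 0 ≤ exp 1 * normV Γ κ ρ (fun m' => ρc ^ 0 * (ε * B m' 0)) *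
      (Φ * normV Γ κ ρ (fun m' => ρc ^ 0 * (ε * B m' 0))) ^ (N₀ - 1) / (1 - Φ * normV Γ κ ρ (fun m' => ρc ^ 0 * (ε * B m' 0))) :=
    div_nonneg (by positivity) (sub_nonneg.2 (((mul_le_mul_of_nonneg_left hV hΦ0).trans hguard.le)))
  exact mul_le_mul hψp htail hTd0 (pow_nonneg hψ0 _)

/-! ## §3 Re-truncation: the whole bracket in the output track's units, kit shape with `Φ ↦ 2Φ` -/

/-- The extra graded orders `n ∈ [N+1, N+K]` sit under the kit tail at `N`: `Σ_{n} e·Φ^{n−1}·ψ^p·towerS_n ≤ ψ^p·e·V·(ΦV)^N/(1 − ΦV)` (`towerS_n ≤ V^n`). -/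
theorem sum_extraOrders_le_kitTail {D p N K : ℕ} {τ ψ Φ : ℝ} {μ : ℕ → ℝ} (hτ : 0 ≤ τ) (hψ : 0 ≤ ψ) (hΦ : 0 ≤ Φ) (hμ : ∀ m, 0 ≤ μ m)
    (hguard : Φ * towerV D τ μ < 1) :
    ∑ n ∈ Ico (N + 1) (N + K + 1), exp 1 * Φ ^ (n - 1) * ψ ^ p * towerS D τ μ n p ≤
      ψ ^ p * (exp 1 * towerV D τ μ * (Φ * towerV D τ μ) ^ N / (1 - Φ * towerV D τ μ)) := by
  set V := towerV D τ μ with hV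
  have hV0 : 0 ≤ V := towerV_nonneg hτ hμ
  have hΦV0 : 0 ≤ Φ * V := mul_nonneg hΦ hV0
  -- termwise: `e Φ^{n−1} ψ^p S_n ≤ ψ^p e V (ΦV)^{n−1}`
  have hterm : ∀ n ∈ Ico (N + 1) (N + K + 1),
      exp 1 * Φ ^ (n - 1) * ψ ^ p * towerS D τ μ n p ≤ ψ ^ p * (exp 1 * V) * (Φ * V) ^ (n - 1) := by
    intro n hn
    have hn1 : 1 ≤ n := by have := (mem_Ico.1 hn).1; omega
    have hS := towerS_le_towerV_pow (D := D) (n := n) (p := p) hτ hμ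
    rw [← hV] at hS
    have hVn : V ^ n = V * V ^ (n - 1) := by rw [← pow_succ', Nat.sub_add_cancel hn1]
    calc exp 1 * Φ ^ (n - 1) * ψ ^ p * towerS D τ μ n p ≤ exp 1 * Φ ^ (n - 1) * ψ ^ p * V ^ n :=
          mul_le_mul_of_nonneg_left hS (by positivity)
      _ = ψ ^ p * (exp 1 * V) * (Φ * V) ^ (n - 1) := by rw [hVn, mul_pow]; ring
  refine (sum_le_sum hterm).trans ?_
  rw [← mul_sum, Finset.sum_Ico_eq_sum_range]
  simp only [show N + K + 1 - (N + 1) = K by omega, show ∀ k, N + 1 + k - 1 = N + k from fun k => by omega]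
  have hgeom : ∑ k ∈ range K, (Φ * V) ^ (N + k) ≤ (Φ * V) ^ N / (1 - Φ * V) := by
    have h := geom_sum_Ico_le_of_lt_one (m := N) (n := N + K) hΦV0 hguard
    rwa [Finset.sum_Ico_eq_sum_range, show N + K - N = K by omega] at h
  calc ψ ^ p * (exp 1 * V) * ∑ k ∈ range K, (Φ * V) ^ (N + k) ≤ ψ ^ p * (exp 1 * V) * ((Φ * V) ^ N / (1 - Φ * V)) :=
        mul_le_mul_of_nonneg_left hgeom (by positivity)
    _ = _ := by ring

/-- Doubling `Φ` absorbs a factor `2` on the kit tail (`N ≥ 1`, `2ΦV < 1`). -/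
theorem two_mul_kitTail_le {V Φ : ℝ} (hV : 0 ≤ V) (hΦ : 0 ≤ Φ) (hguard : 2 * Φ * V < 1) {N : ℕ} (hN : 1 ≤ N) :
    2 * (exp 1 * V * (Φ * V) ^ N / (1 - Φ * V)) ≤ exp 1 * V * (2 * Φ * V) ^ N / (1 - 2 * Φ * V) := by
  have hΦV0 : 0 ≤ Φ * V := mul_nonneg hΦ hV
  have h1 : 0 < 1 - 2 * Φ * V := sub_pos.2 hguard
  have h2 : 1 - 2 * Φ * V ≤ 1 - Φ * V := by nlinarith
  have hpow : 2 * (Φ * V) ^ N ≤ (2 * Φ * V) ^ N := by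
    have h2N : (2 : ℝ) * (Φ * V) ^ N ≤ 2 ^ N * (Φ * V) ^ N := by
      refine mul_le_mul_of_nonneg_right ?_ (pow_nonneg hΦV0 _)
      calc (2 : ℝ) = 2 ^ 1 := (pow_one _).symm
        _ ≤ 2 ^ N := pow_le_pow_right₀ (by norm_num) hN
    calc 2 * (Φ * V) ^ N ≤ 2 ^ N * (Φ * V) ^ N := h2N
      _ = (2 * Φ * V) ^ N := by rw [← mul_pow, mul_assoc]
  rw [← mul_div_assoc]
  refine div_le_div₀ (by positivity) ?_ h1 h2
  calc 2 * (exp 1 * V * (Φ * V) ^ N) = exp 1 * V * (2 * (Φ * V) ^ N) := by ring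
    _ ≤ exp 1 * V * (2 * Φ * V) ^ N := mul_le_mul_of_nonneg_left hpow (by positivity)

/-- **THE PRESCRIBED BRACKET IN THE OUTPUT TRACK'S UNITS** («(I1)-LEV-GRADED-UNITS», kit side).  Graded majorant `ρc^c·ε·B m c ≤ ω c·N m` with `ω ≥ 0`,
`ω 0 ≤ 1`, `ω a·ω b ≤ ω (a+b)`; `N ≥ 0`, `N 0 = 0`; `D ≥ |Γ|/2`; `m + 1 = 2p`; kit parameters `τ ≥ (e³κ)², (e²(κ+ρ))²`, `ψ ≥ κ⁻², ρ⁻²`; the kit's truncation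
`N ≥ 1`; `K` with `(1/2)^K ≤ ω(|Jt|)`; the quantitative guard `2Φ·towerV D τ N < 1` (`Φ = eα/κ²`).  Then the door's bracket AT TRUNCATION `N₀ := N + K + 1` is
`≤ ω(|Jt|)·(Σ_{n ∈ [2, N]} e·(2Φ)^{n−1}·ψ^p·towerS D τ N n p + ψ^p·(e·V·(2Φ·V)^N/(1 − 2Φ·V)))` — the literal kit step shape with `Φ ↦ 2Φ`. -/
theorem doorGradedPrescribed_le_kitStep_graded {Γ : Type*} [Fintype Γ] {Jt : Type*} [Fintype Jt] [DecidableEq Jt]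
    {κ ρ α ρc ε : ℝ} (hκ : 0 < κ) (hρ : 0 < ρ) (hα : 0 ≤ α) (hρc : 0 ≤ ρc) (hε : 0 ≤ ε)
    {B : ℕ → ℕ → ℝ} (hB0 : ∀ m c, 0 ≤ B m c) {N : ℕ → ℝ} (hN0 : ∀ m, 0 ≤ N m) (hN00 : N 0 = 0)
    {ω : ℕ → ℝ} (hω0 : ∀ c, 0 ≤ ω c) (hω1 : ω 0 ≤ 1) (hωmul : ∀ a b, ω a * ω b ≤ ω (a + b))
    (hNB : ∀ m c, ρc ^ c * (ε * B m c) ≤ ω c * N m)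
    {D : ℕ} (hD : Fintype.card Γ / 2 ≤ D) {Nk : ℕ} (hNk : 1 ≤ Nk) {K : ℕ} (hK : (1 / 2 : ℝ) ^ K ≤ ω (Fintype.card Jt))
    {m p : ℕ} (hmp : m + 1 = 2 * p)
    {τ ψ : ℝ} (hτ1 : (exp 3 * κ) ^ 2 ≤ τ) (hτ2 : (exp 2 * (κ + ρ)) ^ 2 ≤ τ) (hψ1 : κ⁻¹ ^ 2 ≤ ψ) (hψ2 : ρ⁻¹ ^ 2 ≤ ψ)
    (hguard2 : 2 * (exp 1 * α / κ ^ 2) * towerV D τ N < 1) :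
    (∑ n ∈ Ico 2 (Nk + K + 1), (κ⁻¹ ^ (m + 1) * κ⁻¹ ^ (2 * (n - 1)) * (α ^ (n - 1) * exp n)) *
        ∑ δ ∈ (Fintype.piFinset fun _ : Fin n => range (Fintype.card Γ / 2 + 1)) with m + 1 + 2 * (n - 1) ≤ ∑ a, 2 * δ a,
          ∑ pf : Jt → Fin n, ((∏ j, ((2 * δ (pf j) : ℕ) : ℝ)) / ((∑ a, 2 * δ a : ℕ) : ℝ) ^ Fintype.card Jt) *
            ∏ a, (exp 3 * κ) ^ (2 * δ a) *
              (ρc ^ (univ.filter fun j : Jt => pf j = a).card * (ε * B (δ a) (univ.filter fun j : Jt => pf j = a).card))) +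
      ρ⁻¹ ^ (m + 1) * (exp 1 * normV Γ κ ρ (fun m' => ρc ^ 0 * (ε * B m' 0))) *
        (exp 1 * α * normV Γ κ ρ (fun m' => ρc ^ 0 * (ε * B m' 0)) / κ ^ 2) ^ (Nk + K + 1 - 1) /
        (1 - exp 1 * α * normV Γ κ ρ (fun m' => ρc ^ 0 * (ε * B m' 0)) / κ ^ 2) ≤
    ω (Fintype.card Jt) *
      (∑ n ∈ Icc 2 Nk, exp 1 * (2 * (exp 1 * α / κ ^ 2)) ^ (n - 1) * ψ ^ p * towerS D τ N n p +
        ψ ^ p * (exp 1 * towerV D τ N * (2 * (exp 1 * α / κ ^ 2) * towerV D τ N) ^ Nk /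
          (1 - 2 * (exp 1 * α / κ ^ 2) * towerV D τ N))) := by
  set Φ := exp 1 * α / κ ^ 2 with hΦ
  set V := towerV D τ N with hVdef
  set w := ω (Fintype.card Jt) with hw
  have hΦ0 : 0 ≤ Φ := by rw [hΦ]; positivity
  have hτ0 : 0 ≤ τ := le_trans (by positivity) hτ1
  have hψ0 : 0 ≤ ψ := le_trans (by positivity) hψ1
  have hV0 : 0 ≤ V := towerV_nonneg hτ0 hN0
  have hw0 : 0 ≤ w := hω0 _
  have hΦV0 : 0 ≤ Φ * V := mul_nonneg hΦ0 hV0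
  have hΦVhalf : Φ * V ≤ 1 / 2 := by nlinarith
  have hguard : Φ * V < 1 := by linarith
  have hNB0 : ∀ m', ρc ^ 0 * (ε * B m' 0) ≤ N m' := fun m' =>
    (hNB m' 0).trans ((mul_le_mul_of_nonneg_right hω1 (hN0 _)).trans_eq (one_mul _))
  -- the three pieces
  have hG := doorGradedPart_le_weight_mul (Γ := Γ) (Jt := Jt) hκ hα hρc hε hB0 hN0 hN00 hω0 hωmul hNB hD (Nk + K + 1) hmp hτ1 hψ1
  have hT := doorTailPart_le_kitTail (Γ := Γ) hκ hρ hα hρc hε hB0 hN0 hN00 hNB0 hD (Nk + K + 1) hmp hτ2 hψ2 hguard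
  set S : ℕ → ℝ := fun n => exp 1 * Φ ^ (n - 1) * ψ ^ p * towerS D τ N n p with hS
  set tail := ψ ^ p * (exp 1 * V * (Φ * V) ^ Nk / (1 - Φ * V)) with htail
  have htail0 : 0 ≤ tail := by
    rw [htail]; exact mul_nonneg (pow_nonneg hψ0 _) (div_nonneg (by positivity) (sub_nonneg.2 hguard.le))
  have hS0 : ∀ n, 0 ≤ S n := fun n => by
    have := towerS_nonneg (D := D) hτ0 hN0 n p; simp only [hS]; positivity
  -- graded orders `[2, Nk+K]` = `[2, Nk]` + the extra orders, the latter under the tail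
  have hsplit : ∑ n ∈ Icc 2 (Nk + K + 1 - 1), S n ≤ ∑ n ∈ Icc 2 Nk, S n + tail := by
    rw [show Nk + K + 1 - 1 = Nk + K by omega]
    rcases Nat.lt_or_ge (Nk + K) 2 with hlt | hge
    · have hK0 : Icc 2 (Nk + K) = ∅ := Finset.Icc_eq_empty (by omega)
      rw [hK0, sum_empty]
      exact add_nonneg (sum_nonneg fun n _ => hS0 n) htail0
    · have hIcc : Icc 2 (Nk + K) = Ico 2 (Nk + K + 1) := by ext n; simp only [mem_Icc, mem_Ico]; omega
      have hIcc' : Icc 2 Nk = Ico 2 (Nk + 1) := by ext n; simp only [mem_Icc, mem_Ico]; omega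
      rw [hIcc, hIcc', ← Finset.sum_Ico_consecutive S (show 2 ≤ Nk + 1 by omega) (show Nk + 1 ≤ Nk + K + 1 by omega)]
      exact add_le_add le_rfl (sum_extraOrders_le_kitTail (D := D) (p := p) (N := Nk) (K := K) hτ0 hψ0 hΦ0 hN0 hguard)
  -- the door's tail at `Nk + K` is `(ΦV)^K ≤ (1/2)^K ≤ ω` times the kit tail at `Nk`
  have htailK : ψ ^ p * (exp 1 * V * (Φ * V) ^ (Nk + K + 1 - 1) / (1 - Φ * V)) ≤ w * tail := by
    rw [show Nk + K + 1 - 1 = Nk + K by omega, htail, pow_add]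
    have hK' : (Φ * V) ^ K ≤ w := le_trans (pow_le_pow_left₀ hΦV0 hΦVhalf K) hK
    have h1 : 0 < 1 - Φ * V := sub_pos.2 hguard
    calc ψ ^ p * (exp 1 * V * ((Φ * V) ^ Nk * (Φ * V) ^ K) / (1 - Φ * V))
        = (Φ * V) ^ K * (ψ ^ p * (exp 1 * V * (Φ * V) ^ Nk / (1 - Φ * V))) := by
          field_simp
      _ ≤ w * (ψ ^ p * (exp 1 * V * (Φ * V) ^ Nk / (1 - Φ * V))) :=
          mul_le_mul_of_nonneg_right hK' (mul_nonneg (pow_nonneg hψ0 _) (div_nonneg (by positivity) h1.le))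
  -- assemble: `≤ w·(S-sum + 2·tail) ≤ w·(S-sum(2Φ) + tail(2Φ))`
  have hsum2 : ∑ n ∈ Icc 2 Nk, S n ≤ ∑ n ∈ Icc 2 Nk, exp 1 * (2 * Φ) ^ (n - 1) * ψ ^ p * towerS D τ N n p :=
    sum_le_sum fun n _ => by
      simp only [hS]
      refine mul_le_mul_of_nonneg_right (mul_le_mul_of_nonneg_right (mul_le_mul_of_nonneg_left
        (pow_le_pow_left₀ hΦ0 (by linarith) _) (exp_pos 1).le) (pow_nonneg hψ0 _)) (towerS_nonneg hτ0 hN0 n p)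
  have htail2 : 2 * tail ≤ ψ ^ p * (exp 1 * V * (2 * Φ * V) ^ Nk / (1 - 2 * Φ * V)) := by
    rw [htail, mul_left_comm]
    exact mul_le_mul_of_nonneg_left (two_mul_kitTail_le hV0 hΦ0 (by rw [hΦ, hVdef]; linarith [hguard2]) hNk) (pow_nonneg hψ0 _)
  calc _ ≤ w * ∑ n ∈ Icc 2 (Nk + K + 1 - 1), S n + w * tail := add_le_add hG (hT.trans htailK)
    _ ≤ w * (∑ n ∈ Icc 2 Nk, S n + tail) + w * tail := add_le_add (mul_le_mul_of_nonneg_left hsplit hw0) le_rfl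
    _ = w * (∑ n ∈ Icc 2 Nk, S n + 2 * tail) := by ring
    _ ≤ w * (∑ n ∈ Icc 2 Nk, exp 1 * (2 * Φ) ^ (n - 1) * ψ ^ p * towerS D τ N n p +
          ψ ^ p * (exp 1 * V * (2 * Φ * V) ^ Nk / (1 - 2 * Φ * V))) :=
        mul_le_mul_of_nonneg_left (add_le_add hsum2 htail2) hw0
    _ = _ := by rw [hΦ]

/-! ## §4 The first-order term reads its one vertex at `c = |J|` -/

/-- **THE BINOMIAL-PRESCRIBED SUM IN THE OUTPUT TRACK'S UNITS**: under the graded majorant the literal `J`-form first-order sum is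
`≤ ω(|J|)·((e²)^{q+2}/2·towerFO D κ² N (q+1))`. -/
theorem doorBinomialPrescribedJ_le_towerFO_graded {κ ρc ε : ℝ} (hκ : 0 ≤ κ) (hρc : 0 ≤ ρc) (hε : 0 ≤ ε)
    {B : ℕ → ℕ → ℝ} (hB0 : ∀ m c, 0 ≤ B m c) {N : ℕ → ℝ} (hN0 : ∀ m, 0 ≤ N m)
    {ω : ℕ → ℝ} (hω0 : ∀ c, 0 ≤ ω c) (hNB : ∀ m c, ρc ^ c * (ε * B m c) ≤ ω c * N m)
    {DΓ D : ℕ} (hD : DΓ ≤ D) (q : ℕ) (J : Finset (Fin (2 * (q + 1)))) :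
    ∑ m' ∈ range (DΓ + 1), (if q + 1 < m' then
        ((((2 * (q + 1)) ! : ℝ))⁻¹ * ((∏ j ∈ univ.filter (fun j : Fin (2 * (q + 1)) => j ∉ J), (2 * m' - (j : ℕ)) : ℕ) : ℝ)) *
          ((2 * m' : ℕ) : ℝ) ^ J.card * κ ^ (2 * m' - 2 * (q + 1)) * (ρc ^ J.card * (ε * B m' J.card)) else 0) ≤
      ω J.card * (exp 2 ^ (q + 2) / 2 * towerFO D (κ ^ 2) N (q + 1)) := by
  -- read the vertex at level `|J|` only: sizes `B̃ m c := [c = |J|]·B m c`, majorant `ω(|J|)·N`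
  set Bt : ℕ → ℕ → ℝ := fun m c => if c = J.card then B m c else 0 with hBt
  have hBt0 : ∀ m c, 0 ≤ Bt m c := fun m c => by simp only [hBt]; split_ifs <;> [exact hB0 _ _; exact le_rfl]
  have hNBt : ∀ m c, ρc ^ c * (ε * Bt m c) ≤ ω J.card * N m := fun m c => by
    simp only [hBt]
    split_ifs with hc
    · rw [hc]; exact hNB _ _
    · rw [mul_zero, mul_zero]; exact mul_nonneg (hω0 _) (hN0 _)
  have h := doorBinomialPrescribedJ_le_towerFO hκ hρc hε hBt0 hNBt hD q J
  have hBJ : ∀ m', Bt m' J.card = B m' J.card := fun m' => by simp only [hBt, if_true]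
  simp only [hBJ] at h
  rwa [towerFO_mul_left, ← mul_assoc, mul_comm (exp 2 ^ (q + 2) / 2) (ω J.card), mul_assoc] at h

end Summit.HubbardSuperconductivity.HubbardSuperconductivity.Theorems.EngineV8

end
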